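import Mathlib

/-!
# Cross-copy orthogonality by polarisation (Tier 5, sub-step N3, Lemma N3.L4)

Kernel annex for Tier 5 (README §7), filed by p8 as a companion to the independent re-derivation
memo `route/T5-CHECK-N3-p8.md` of route-2's `route/T5-N3-route-2.md` (Proposition N*).

Lemma N3.L4 of that section («cross-copy orthogonality») is the cell's own argument: for two
orthonormal vectors `m, m'` of the multiplicity space `M` of an isotypic component `Π(π₀) ≅ π₀ ⊗ M`,
the theta lifts of `v ⊗ m` and `v₁ ⊗ m'` are orthogonal, and the lifts of `v ⊗ m`, `v₁ ⊗ m` pair to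
the same number `R(v, v₁; φ₁, φ₂)` for every copy. The printed input is the Rallis inner product
formula (Gan–Qiu–Takeda 2014, Theorem 33(i)) applied to EVERY copy `π₀ ⊗ u` (`u ∈ M` a unit
vector): it gives `⟪Θ(v ⊗ u, φ₁), Θ(v₁ ⊗ u, φ₂)⟫ = R` for all unit `u`, with the SAME right-hand
side `R` because that side depends only on the abstract local data. Everything after that is the
elementary algebra kernel-checked here:

* `eq_zero_of_diag_zero` — a form `s : M → M → ℂ`, additive in each variable, whose two scalings by
  `I` have DISTINCT factors `c₁ ≠ c₂` (the two sesquilinear types), vanishes identically as soon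
  as it vanishes on the diagonal.
* `inner_map_eq_of_diag` — for ℂ-LINEAR `A B : M → E` with `⟪A u, B u⟫ = R ⟪u, u⟫` for all `u`:
  `⟪A m, B m'⟫ = R ⟪m, m'⟫`.
* `inner_conjMap_eq_of_diag` — for CONJUGATE-linear `A B` (the lifts `u ↦ Θ(v ⊗ u, φ)` are
  antilinear in `f = v ⊗ u`) with the same diagonal hypothesis: `⟪A m, B m'⟫ = R ⟪m', m⟫`.
* `crossCopy_orthogonal`, `crossCopy_same` — Lemma N3.L4 as stated: orthogonal copies give
  orthogonal lifts; the diagonal value is the same `R` on every unit copy.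

Mathlib's inner product `⟪x, y⟫_ℂ` is conjugate-linear in `x` and linear in `y`. Nothing automorphic
is asserted: the hypothesis `h` IS the printed Theorem 33(i) read on all copies.
-/

namespace Summit.Ventures.HodgeRepro2.T5Reduction

open scoped InnerProductSpace

section Abstract

variable {M : Type*} [AddCommGroup M] [Module ℂ M]

/-- Polarisation in its simplest form: a map `s : M → M → ℂ`, additive in each variable, such that
`s (I • u) w = c₁ * s u w` and `s u (I • w) = c₂ * s u w` with `c₁ ≠ c₂`, which vanishes on the
diagonal, vanishes identically. (For `c₁ = conj I = -I, c₂ = I` this is the sesquilinear type of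
`⟪A u, B w⟫` with `A, B` linear; for `c₁ = I, c₂ = -I` the type with `A, B` conjugate-linear.) -/
theorem eq_zero_of_diag_zero (s : M → M → ℂ) (c₁ c₂ : ℂ) (hne : c₁ ≠ c₂)
    (hadd₁ : ∀ u v w, s (u + v) w = s u w + s v w)
    (hadd₂ : ∀ u v w, s u (v + w) = s u v + s u w)
    (hI₁ : ∀ u w, s (Complex.I • u) w = c₁ * s u w)
    (hI₂ : ∀ u w, s u (Complex.I • w) = c₂ * s u w)
    (hdiag : ∀ u, s u u = 0) (m m' : M) : s m m' = 0 := by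
  have e₁ := hdiag (m + m')
  simp only [hadd₁, hadd₂, hdiag, zero_add, add_zero] at e₁
  have e₂ := hdiag (m + Complex.I • m')
  simp only [hadd₁, hadd₂, hI₁, hI₂, hdiag, zero_add, add_zero, mul_zero] at e₂
  have key : (c₂ - c₁) * s m m' = 0 := by
    linear_combination e₂ - c₁ * e₁
  rcases mul_eq_zero.1 key with h | h
  · exact absurd (sub_eq_zero.1 h).symm hne
  · exact h

end Abstract

section InnerProduct

variable {M E : Type*} [NormedAddCommGroup M] [InnerProductSpace ℂ M]
  [NormedAddCommGroup E] [InnerProductSpace ℂ E]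

/-- Two ℂ-linear maps whose diagonal pairings are `R ⟪u, u⟫` pair as `R ⟪m, m'⟫` everywhere. -/
theorem inner_map_eq_of_diag (A B : M →ₗ[ℂ] E) (R : ℂ)
    (h : ∀ u : M, ⟪A u, B u⟫_ℂ = R * ⟪u, u⟫_ℂ) (m m' : M) :
    ⟪A m, B m'⟫_ℂ = R * ⟪m, m'⟫_ℂ := by
  have hz := eq_zero_of_diag_zero (fun u w => ⟪A u, B w⟫_ℂ - R * ⟪u, w⟫_ℂ)
    (-Complex.I) Complex.I (by
      intro hc
      have : (2 : ℂ) * Complex.I = 0 := by linear_combination -hc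
      simp at this)
    (fun u v w => by simp only [map_add, inner_add_left]; ring)
    (fun u v w => by simp only [map_add, inner_add_right]; ring)
    (fun u w => by simp only [map_smul, inner_smul_left, Complex.conj_I]; ring)
    (fun u w => by simp only [map_smul, inner_smul_right]; ring)
    (fun u => by simp only [h u]; ring) m m'
  exact sub_eq_zero.1 hz

/-- Two CONJUGATE-linear maps (the theta lifts `u ↦ Θ(v ⊗ u, φ)`, antilinear in `f`) whose diagonal
pairings are `R ⟪u, u⟫` pair as `R ⟪m', m⟫` everywhere. -/
theorem inner_conjMap_eq_of_diag (A B : M →ₗ⋆[ℂ] E) (R : ℂ)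
    (h : ∀ u : M, ⟪A u, B u⟫_ℂ = R * ⟪u, u⟫_ℂ) (m m' : M) :
    ⟪A m, B m'⟫_ℂ = R * ⟪m', m⟫_ℂ := by
  have hz := eq_zero_of_diag_zero (fun u w => ⟪A u, B w⟫_ℂ - R * ⟪w, u⟫_ℂ)
    Complex.I (-Complex.I) (by
      intro hc
      have : (2 : ℂ) * Complex.I = 0 := by linear_combination hc
      simp at this)
    (fun u v w => by simp only [map_add, inner_add_left, inner_add_right]; ring)
    (fun u v w => by simp only [map_add, inner_add_right, inner_add_left]; ring)
    (fun u w => by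
      simp only [map_smulₛₗ, inner_smul_left, inner_smul_right, Complex.conj_I, map_neg, neg_neg]
      ring)
    (fun u w => by
      simp only [map_smulₛₗ, inner_smul_right, inner_smul_left, Complex.conj_I]
      ring)
    (fun u => by simp only [h u]; ring) m m'
  exact sub_eq_zero.1 hz

/-- Homogeneity: Theorem 33(i) is read on UNIT copies `u`; the hypothesis `⟪A u, B u⟫ = R ⟪u, u⟫`
for ALL `u` follows by scaling (`A`, `B` conjugate-linear: `⟪A (c • u), B (c • u)⟫ = |c|² ⟪A u, B u⟫`). -/
theorem diag_of_unit (A B : M →ₗ⋆[ℂ] E) (R : ℂ)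
    (h : ∀ u : M, ‖u‖ = 1 → ⟪A u, B u⟫_ℂ = R) (u : M) : ⟪A u, B u⟫_ℂ = R * ⟪u, u⟫_ℂ := by
  by_cases hu : u = 0
  · subst hu
    simp
  · have hn : ‖u‖ ≠ 0 := norm_ne_zero_iff.2 hu
    have hnorm : ‖((‖u‖⁻¹ : ℝ) : ℂ) • u‖ = 1 := by
      rw [norm_smul, Complex.norm_real, Real.norm_eq_abs, abs_inv, abs_norm, inv_mul_cancel₀ hn]
    have hR := h _ hnorm
    rw [map_smulₛₗ, map_smulₛₗ, inner_smul_left, inner_smul_right, Complex.conj_ofReal,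
      Complex.conj_ofReal, Complex.ofReal_inv] at hR
    rw [inner_self_eq_norm_sq_to_K]
    have hr : ((‖u‖ : ℝ) : ℂ) ≠ 0 := by exact_mod_cast hn
    field_simp at hR
    linear_combination hR

/-- Lemma N3.L4, first identity: lifts of ORTHOGONAL copies are orthogonal. -/
theorem crossCopy_orthogonal (A B : M →ₗ⋆[ℂ] E) (R : ℂ)
    (h : ∀ u : M, ⟪A u, B u⟫_ℂ = R * ⟪u, u⟫_ℂ) {m m' : M} (hmm' : ⟪m', m⟫_ℂ = 0) :
    ⟪A m, B m'⟫_ℂ = 0 := by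
  rw [inner_conjMap_eq_of_diag A B R h m m', hmm', mul_zero]

/-- Lemma N3.L4, second identity: the diagonal value is the same `R` on every unit copy. -/
theorem crossCopy_same (A B : M →ₗ⋆[ℂ] E) (R : ℂ)
    (h : ∀ u : M, ⟪A u, B u⟫_ℂ = R * ⟪u, u⟫_ℂ) {m m' : M} (hm : ‖m‖ = 1) (hm' : ‖m'‖ = 1) :
    ⟪A m, B m⟫_ℂ = ⟪A m', B m'⟫_ℂ := by
  rw [h m, h m', inner_self_eq_norm_sq_to_K, inner_self_eq_norm_sq_to_K, hm, hm']

end InnerProduct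

end Summit.Ventures.HodgeRepro2.T5Reduction
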